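import Summits.QuantumFields.YangMills.Theorems.BalabanUVNodesK0BgProvisoOverRangeWitness
import Literature.MathematicalPhysics.QuantumFieldTheory.Balaban1983to89.Node00.BgProvisoRangedOfRecord

/-!
# K0′ ∕ RECORD13 gate ROW P11 — the RANGED token `BgProvisoΛ` PASSES the negative certificate's witness (sanity, part 3)

Cell `pub-ymgap`, seat `pub-ymgap-dag-n21-c` (g4), `--supports stmt-QuantumFields-19902 --as helper` (K0′, ROW P11).  COUNT-NEUTRAL.

Parts 1–2 (`…K0BgProvisoOverRange`, `…Witness`) certify that 11c's UNRANGED `Node00.BgProviso` is refuted at `N = 2` by a datum living at the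
ALL-EMPTY sequence `Ω_j = Λ_j = ∅` (there the (2.12) background of record is the scale-`0` field itself).  def-R's REPAIR — the ranged token
`Node00.BgProvisoΛ` (`Node00/BgProvisoRangedOfRecord.lean`: the `spaceI` conjunct only for `domSites X ⊆ Λ_j(s)`, print's (2.26)–(2.27)∕(2.30) range,
the `spaceMS` conjunct only on `admB` = print's (2.41) range «X ∩ Ω_j ≠ ∅, X ∩ Z_j^∼ ≠ ∅»), over which def-T re-keys `Provisos₁₃.bg` (Record13 v1.1) —
REMOVES EXACTLY THAT DEFECT: at every all-empty sequence, every scale `j ≥ 1` and every `X ∈ 𝐃_j` (cube side `≥ 1`, i.e. `M ≥ 1`) BOTH ranged clauses are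
vacuous — `domSites X` is non-empty and `Λ_j(s) = ∅`; `domSites X ∩ Ω_j(s) = ∅` — so the per-`(s, 𝐖, j, X)` clause of `BgProvisoΛ` HOLDS for EVERY support
set and EVERY background map (`bgProvisoΛ_clause_of_forall_empty`), in particular at the refuting datum of part 2 (`bgProvisoΛ_clause_at_witness_seq`).
What the ranged token still demands is print's: [15] Thm 1 (8),(10) at def-R's objects on `X ⊂ Λ_j` (def-P11's positive side) — untouched here.

HONEST FRAMING.  Bookkeeping (A2-style evidence for the gate: the repair is not vacuous-by-accident elsewhere — `bgProvisoΛ_one` — and is exactly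
vacuous where the unranged token was false); nothing of Bałaban's asserted; 0 `def`, 0 `sorry`; one finite `T⁴` at fixed `ε`; not continuum ∕ OS ∕ mass-gap ∕ Clay.
-/

open scoped Matrix.Norms.L2Operator

namespace Summit.QuantumFields.YangMills.Theorems.K0BgProvisoOverRange

open Literature.MathematicalPhysics.QuantumFieldTheory.Balaban1983to89
open Literature.MathematicalPhysics.QuantumFieldTheory.Balaban1983to89.Node00
open Literature.MathematicalPhysics.QuantumFieldTheory.Balaban1983to89.T4Continuum
open B15Eq112TorusCover B14DomainGeom

noncomputable section

variable {F : T4Family} {N : ℕ}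

/-- Along an all-empty sequence the small-field regions are empty too: `Λ_j(s) ⊆ Ω_j(s) = ∅` in the window ((2.1)), `∅` off it (`Seq.Λ_off`).
[cite: Balaban1988Convergent, (2.1) p.254 (bookkeeping)] -/
theorem seq_Λ_eq_empty_of_forall_empty {ν : Stage7Numerics} {M : ℕ} {g : ℕ → ℝ} {K n : ℕ} (s : SeqOfRecord F ν M g K n) (hs : ∀ j, s.Ω j = ∅)
    (j : ℕ) : s.Λ j = ∅ := by
  by_cases hj : 1 ≤ j ∧ j ≤ n
  · exact Set.subset_eq_empty (s.chain.Λ_subset j hj.1 hj.2) (hs j)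
  · exact s.Λ_off j hj

/-- **A localization domain has a site** (cube side `L^j·M ≥ 1`): the corner `π(side·a)` of any of its cubes. [cite: Balaban1987RG1, p.257 (bookkeeping)] -/
theorem domSites_nonempty {P : Params} {M : ℕ} (hM : 1 ≤ M) (j : ℕ) (X : (Sect2.domSys P M j).Dom) : (Sect2.domSites P M j X).Nonempty := by
  obtain ⟨x, hx⟩ := X.2.1
  have hsd1 : (1 : ℤ) ≤ (B14.Eq213MaximalDomains.side P.L M j : ℤ) := by
    have : 1 ≤ B14.Eq213MaximalDomains.side P.L M j := by
      unfold B14.Eq213MaximalDomains.side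
      exact Nat.one_le_iff_ne_zero.mpr (Nat.mul_ne_zero (pow_ne_zero _ P.L_pos.ne') (by omega))
    exact_mod_cast this
  refine ⟨cover P (fun i => (B14.Eq213MaximalDomains.side P.L M j : ℤ) * Sect2.liftIdx P x i), ?_⟩
  simp only [Sect2.domSites, Set.mem_iUnion]
  refine ⟨x, hx, ⟨fun i => (B14.Eq213MaximalDomains.side P.L M j : ℤ) * Sect2.liftIdx P x i, fun i => ⟨?_, ?_⟩, rfl⟩⟩
  · simp
  · push_cast; linarith

/-- **THE RANGED CLAUSE IS VACUOUS ALONG EVERY ALL-EMPTY SEQUENCE** — for EVERY support set and EVERY background map: `domSites X ≠ ∅ = Λ_j(s)` kills the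
`spaceI` antecedent, `domSites X ∩ Ω_j(s) = ∅` kills `admB`.  (The unranged token demanded `spaceI`-membership here and was refuted exactly here, part 2.)
[cite: Balaban1988Convergent, (2.27) p.259, (2.41) p.261 (the ranges)] -/
theorem bgProvisoΛ_clause_of_forall_empty {𝔸 : Type*} [NormedRing 𝔸] [NormedAlgebra ℂ 𝔸] [CompleteSpace 𝔸] {K : ℕ} (S : Sect2.Setting 𝔸 (SU N))
    (Rz : Sect2.Residual (F.P K) 𝔸) {ν : Stage7Numerics} {M : ℕ} (hM : 1 ≤ M) {g : ℕ → ℝ} {n : ℕ} (s : SeqOfRecord F ν M g K n) (hs : ∀ j, s.Ω j = ∅)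
    (U : GaugeField (F.P K) 0 (SU N)) (j : ℕ) (X : (Sect2.domSys (F.P K) M j).Dom) :
    (Sect2.domSites (F.P K) M j X ⊆ s.Λ j →
      Sect2.ofBackgroundC S.ι U ∈ Sect2.spaceI S Rz M j (Sect2.domSites (F.P K) M j X) (S.lf.alpha0 (S.flow.g j)) (S.lf.alpha1 (S.flow.g j))) ∧
    (Sect2.admB (F.P K) ν M g s.Ω s.Λ j (Sect2.domSites (F.P K) M j X) = true →
      Sect2.ofBackgroundC S.ι U ∈ Sect2.spaceMS S Rz M j (Sect2.domSites (F.P K) M j X) s.Ω) := by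
  refine ⟨fun hX => ?_, fun hB => ?_⟩
  · obtain ⟨y, hy⟩ := domSites_nonempty hM j X
    have := hX hy
    rw [seq_Λ_eq_empty_of_forall_empty s hs j] at this
    exact this.elim
  · rw [Sect2.admB_eq_true_iff] at hB
    obtain ⟨⟨y, hy⟩, -⟩ := hB
    rw [hs j, Set.inter_empty] at hy
    exact hy.elim

/-- **HENCE THE RANGED TOKEN, RESTRICTED TO THE ALL-EMPTY SEQUENCES, HOLDS FOR EVERY SUPPORT AND EVERY BACKGROUND MAP** (`M ≥ 1`) — in particular for
def-R's `regSuppOfRecord … cR` ∕ `UbgMSOfRecord …` at the refuting datum of `not_bgProviso_of_smallRadius`: the repair removes the located defect and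
demands nothing new there. [cite: Balaban1988Convergent, (2.27) p.259, (2.41) p.261 (the ranges)] -/
theorem bgProvisoΛ_clause_at_witness_seq {𝔸 : Type*} [NormedRing 𝔸] [NormedAlgebra ℂ 𝔸] [CompleteSpace 𝔸] {K : ℕ} (S : Sect2.Setting 𝔸 (SU N))
    (Rz : Sect2.Residual (F.P K) 𝔸) {ν : Stage7Numerics} {M : ℕ} (hM : 1 ≤ M) {g : ℕ → ℝ} {n : ℕ}
    (Supp : SeqOfRecord F ν M g K n → Set (B15DeterminingSets.MSField (F.P K) (SU N))) (U : SeqOfRecord F ν M g K n → BgMap F N K)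
    (s : SeqOfRecord F ν M g K n) (hs : ∀ j, s.Ω j = ∅) (W : B15DeterminingSets.MSField (F.P K) (SU N)) (_hW : W ∈ Supp s)
    (j : ℕ) (_h1 : 1 ≤ j) (X : (Sect2.domSys (F.P K) M j).Dom) :
    (Sect2.domSites (F.P K) M j X ⊆ s.Λ j →
      Sect2.ofBackgroundC S.ι (U s W) ∈ Sect2.spaceI S Rz M j (Sect2.domSites (F.P K) M j X) (S.lf.alpha0 (S.flow.g j)) (S.lf.alpha1 (S.flow.g j))) ∧
    (Sect2.admB (F.P K) ν M g s.Ω s.Λ j (Sect2.domSites (F.P K) M j X) = true →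
      Sect2.ofBackgroundC S.ι (U s W) ∈ Sect2.spaceMS S Rz M j (Sect2.domSites (F.P K) M j X) s.Ω) :=
  bgProvisoΛ_clause_of_forall_empty S Rz hM s hs (U s W) j X

/-- **THE TWO TOKENS SEPARATED AT `N = 2`** (the located defect in one line): under part 2's smallness the UNRANGED `BgProviso` over def-R's objects is FALSE,
while the RANGED token's clause at the refuting (all-empty) sequence is TRUE for the same objects — so `BgProviso` is NOT recoverable from `BgProvisoΛ`
(the converse of def-R's `bgProvisoΛ_of_bgProviso` fails), and the re-keyed `Provisos₁₃.bg` no longer meets this certificate.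
[cite: Balaban1988Convergent, (2.27)–(2.28) p.259] -/
theorem not_bgProviso_and_bgProvisoΛ_clause {K : ℕ} (S : Sect2.Setting (MatA 2) (SU 2)) (hι : S.ι = ιSU 2) (Rz : Sect2.Residual (F.P K) (MatA 2))
    {ν : Stage7Numerics} {M : ℕ} {g : ℕ → ℝ} {n : ℕ} {cR : ℝ} (hn : 1 ≤ n) (hM : 1 ≤ M) (s₀ : ℝ) (hs0 : 0 ≤ s₀) (hs1 : s₀ ≤ 1)
    (hsupp : 8 * s₀ < cR * epsOfRecord ν g 0) (hreg : 8 * s₀ < ν.εreg) (hα : S.lf.alpha0 (S.flow.g n) * (F.P K).eta n ^ 2 ≤ 2 * s₀ ^ 2) :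
    ¬ BgProviso F 2 K S Rz M n (regSuppOfRecord F 2 ν M g K n cR) (UbgMSOfRecord F 2 ν M g K n) ∧
      ∃ s : SeqOfRecord F ν M g K n, (∀ j, s.Ω j = ∅) ∧ ∀ W j, 1 ≤ j → ∀ X : (Sect2.domSys (F.P K) M j).Dom,
        (Sect2.domSites (F.P K) M j X ⊆ s.Λ j →
          Sect2.ofBackgroundC S.ι (UbgMSOfRecord F 2 ν M g K n s W) ∈
            Sect2.spaceI S Rz M j (Sect2.domSites (F.P K) M j X) (S.lf.alpha0 (S.flow.g j)) (S.lf.alpha1 (S.flow.g j))) ∧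
        (Sect2.admB (F.P K) ν M g s.Ω s.Λ j (Sect2.domSites (F.P K) M j X) = true →
          Sect2.ofBackgroundC S.ι (UbgMSOfRecord F 2 ν M g K n s W) ∈ Sect2.spaceMS S Rz M j (Sect2.domSites (F.P K) M j X) s.Ω) := by
  obtain ⟨s, hs⟩ := exists_seqOfRecord_forall_empty (F := F) ν M g K n
  exact ⟨not_bgProviso_of_smallRadius S hι Rz hn hM s₀ hs0 hs1 hsupp hreg hα, s, hs,
    fun W j _ X => bgProvisoΛ_clause_of_forall_empty S Rz hM s hs _ j X⟩

end

end Summit.QuantumFields.YangMills.Theorems.K0BgProvisoOverRange
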